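import Literature.AlgebraicGeometry.Frobenioids.BiratUnitsIntertwines
import Literature.AlgebraicGeometry.Frobenioids.BiratUnitsPush
import Literature.AlgebraicGeometry.Frobenioids.BirationalizationIsos
import HarnessLib

/-!
# Frobenioids I, Proposition 2.2 (ii) for `C^birat`: transport of `O^×(A^birat)` along linear
morphisms

Mochizuki, *The geometry of Frobenioids I: the general theory*, Kyushu J. Math. **62** (2008)
293–400, §2 Proposition 2.2 (ii), kurims text p. 45 ll. 24–31 [cite: MochizukiFrdI2008, Prop. 2.2(ii)
p.45], verbatim (the functor and its object map are one display in print): "There is a unique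
contravariant functor `D^* → Mon` `Ob(C^istr) = Ob(D^*) ∋ A ↦ O^▷(A) ∈ Ob(Mon)` such that for
`φ : A → B` in `Arr(C^istr)`, with
image `φ_{D^*}` in `D^*`, the following properties are satisfied: (a) if `φ` is a [necessarily
co-angular – cf. Proposition 1.4, (i)] linear morphism, then `O^▷(φ_{D^*}) : O^▷(B) → O^▷(A)` is the
inclusion of Proposition 1.11, (iv); (b) if `φ` is a [necessarily co-angular] pre-step, then
`O^▷(φ_{D^*}) : O^▷(B) → O^▷(A)` is the bijection of Definition 1.3, (iii), (c)."  Used together with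
Def. 1.3 (iv)(a) (the factorisation `φ = α ∘ β ∘ γ`: pull-back ∘ pre-step ∘ Frobenius-type) and
§4 Proposition 4.4 (ii) p. 83 ll. 22–24, verbatim: "We shall refer to the functor “`O^×(−)`” on `D`
associated to the Frobenioid `C^birat` [cf. Proposition 2.2, (ii), (iii)] as the rational function
monoid of the Frobenioid `C`."

What this file does (our words, not print's): it builds the morphism part of that functor for the
units `O^×(A^birat)` of the birationalization DIRECTLY in `C`, without first establishing that
`C^birat` is a Frobenioid.  Along a LINEAR morphism `ψ : A → A'` of a Frobenioid of isotropic type,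
every rational function `v ∈ O^×(A'^birat)` has a unique transport `u ∈ O^×(A^birat)` satisfying
the intertwining relation `ψ^birat ∘ u = v ∘ ψ^birat` in `C^birat` (the predicate
`BiratUnits.Intertwines`; this relation is our formulation, it is not a quotation):
factor `ψ = γ ≫ β ≫ α` (Def. 1.3 (iv)(a); `γ` is then a co-angular pre-step), transport along the
pull-back morphism `α` (`BiratUnitsIntertwines.pullbackHom`) and along the pre-steps `β`, `γ`
(`BiratUnitsPush.pushEquiv⁻¹`), and compose the three commuting squares; uniqueness by cancelling
the
isomorphisms `γ^birat`, `β^birat` (`BirationalizationIsos.lean`) and the pull-back `α`.  Result: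
the homomorphism
`BiratUnits.transportHom ψ : O^×(A'^birat) →* O^×(A^birat)` characterised by the intertwining
relation —
the value on `Base ψ` of the rational-function-monoid functor.
-/

namespace Literature.AlgebraicGeometry.Frobenioids

open CategoryTheory Opposite

universe w v v' u u'

namespace PreFrobenioid

namespace BiratUnits

variable {D : Type u} [Category.{v} D] {Φ : Dᵒᵖ ⥤ CommMonCat.{w}}
  {C : Type u'} [Category.{v'} C] {F : C ⥤ ElemFrobenioid Φ} {hF : IsFrobenioid F}
  {hsq : HasBiratSquares F} {A A' A'' : C}

/-- Intertwinings compose along `ψ₁ ≫ ψ₂` (pasting of commuting squares in `C^birat`).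
[cite: MochizukiFrdI2008, Prop. 2.2(ii) p.45] -/
theorem Intertwines.comp (hsq : HasBiratSquares F) {ψ₁ : A ⟶ A'} {ψ₂ : A' ⟶ A''}
    {u : BiratUnits F hF A} {m : BiratUnits F hF A'} {v : BiratUnits F hF A''}
    (h₁ : Intertwines hF ψ₁ u m) (h₂ : Intertwines hF ψ₂ m v) : Intertwines hF (ψ₁ ≫ ψ₂) u v := by
  rw [intertwines_iff_toHom_comm hsq] at h₁ h₂ ⊢
  rw [Functor.map_comp, ← Category.assoc, h₁, Category.assoc, h₂, Category.assoc]

/-- Along a co-angular pre-step `ψ`, `(pushEquiv ψ)⁻¹ v` is intertwined with `v`.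
[cite: MochizukiFrdI2008, Prop. 2.2(ii) p.45] -/
theorem intertwines_pushEquiv_symm (ψ : A ⟶ A') (hψ : IsCoAngularPreStep F ψ)
    (v : BiratUnits F hF A') : Intertwines hF ψ ((pushEquiv hF ψ hψ).symm v) v := by
  rw [intertwines_iff_push_eq]
  exact (pushEquiv hF ψ hψ).apply_symm_apply v

variable (hF) in
/-- **Existence** of the transport along a linear morphism (isotropic type).
[cite: MochizukiFrdI2008, Prop. 2.2(ii) p.45] -/
theorem exists_intertwines_of_isLinear (hsq : HasBiratSquares F) (hiso : IsOfIsotropicType F)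
    (ψ : A ⟶ A') (hψ : IsLinear F ψ) (v : BiratUnits F hF A') :
    ∃ u : BiratUnits F hF A, Intertwines hF ψ u v := by
  obtain ⟨X, Y, γ, β, α, hfac, hγ, hβ, hα⟩ := hF.iv_a_exists ψ
  have hγc := Birat.isCoAngularPreStep_of_factorisation hF hψ hfac hγ hβ hα
  have hβc : IsCoAngularPreStep F β := isCoAngularPreStep_of_isotropic hiso hβ
  obtain ⟨m, hm⟩ := exists_intertwines_of_isPullbackMorphism hF hiso α hα v
  refine ⟨(pushEquiv hF γ hγc).symm ((pushEquiv hF β hβc).symm m), ?_⟩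
  rw [← hfac]
  exact (intertwines_pushEquiv_symm γ hγc _).comp hsq
    ((intertwines_pushEquiv_symm β hβc _).comp hsq hm)

/-- **Uniqueness** of the transport along a linear morphism (isotropic type): cancel the
isomorphisms
`γ^birat ≫ β^birat` and then the pull-back `α` (`eq_of_toHom_comp_eq`).
[cite: MochizukiFrdI2008, Prop. 1.11(iv) p.36] -/
theorem eq_of_intertwines_of_isLinear (hsq : HasBiratSquares F) (hiso : IsOfIsotropicType F)
    {ψ : A ⟶ A'} (hψ : IsLinear F ψ) {u u' : BiratUnits F hF A} {v : BiratUnits F hF A'}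
    (h : Intertwines hF ψ u v) (h' : Intertwines hF ψ u' v) : u = u' := by
  obtain ⟨X, Y, γ, β, α, hfac, hγ, hβ, hα⟩ := hF.iv_a_exists ψ
  have hγc := Birat.isCoAngularPreStep_of_factorisation hF hψ hfac hγ hβ hα
  have hβc : IsCoAngularPreStep F β := isCoAngularPreStep_of_isotropic hiso hβ
  -- `x ↦ push β (push γ x)` is intertwined with `x` along `γ ≫ β`
  have hw : ∀ x : BiratUnits F hF A,
      Intertwines hF (γ ≫ β) x (push hF β hβc (push hF γ hγc x)) := fun x =>
    ((intertwines_iff_push_eq γ hγc x _).mpr rfl).comp hsq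
      ((intertwines_iff_push_eq β hβc _ _).mpr rfl)
  have e : ∀ x : BiratUnits F hF A, toHom hsq x ≫ (toBirat F hF hsq).map ψ =
      (toBirat F hF hsq).map (γ ≫ β) ≫
        (toHom hsq (push hF β hβc (push hF γ hγc x)) ≫ (toBirat F hF hsq).map α) := fun x => by
    rw [← hfac, ← Category.assoc γ β α, Functor.map_comp, ← Category.assoc,
      (intertwines_iff_toHom_comm hsq _ _ _).mp (hw x), Category.assoc]
  have e' : (toBirat F hF hsq).map ψ ≫ toHom hsq v =
      (toBirat F hF hsq).map (γ ≫ β) ≫ ((toBirat F hF hsq).map α ≫ toHom hsq v) := by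
    rw [← hfac, ← Category.assoc γ β α, Functor.map_comp, Category.assoc]
  rw [intertwines_iff_toHom_comm hsq, e, e'] at h h'
  haveI : IsIso ((toBirat F hF hsq).map (γ ≫ β)) :=
    Birat.isIso_toBirat_map (hF := hF) (hsq := hsq) (γ ≫ β) (hγc.comp hF hβc)
  have key := (cancel_epi _).mp (h.trans h'.symm)
  exact push_injective γ hγc (push_injective β hβc (eq_of_toHom_comp_eq hα key))

variable (hF) in
/-- **Prop. 2.2 (ii) for `C^birat`**: the transport homomorphism `O^×(A'^birat) → O^×(A^birat)`
along a
linear morphism `ψ : A → A'` of a Frobenioid of isotropic type, `v ↦` the unique `u` with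
`ψ ∘ u = v ∘ ψ` — the value on `Base ψ` of the rational function monoid as a functor on `D`.
[cite: MochizukiFrdI2008, Prop. 2.2(ii) p.45] -/
noncomputable def transportHom (hsq : HasBiratSquares F) (hiso : IsOfIsotropicType F)
    (ψ : A ⟶ A') (hψ : IsLinear F ψ) : BiratUnits F hF A' →* BiratUnits F hF A where
  toFun v := (exists_intertwines_of_isLinear hF hsq hiso ψ hψ v).choose
  map_one' := eq_of_intertwines_of_isLinear hsq hiso hψ
    (exists_intertwines_of_isLinear hF hsq hiso ψ hψ 1).choose_spec (Intertwines.one hsq ψ)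
  map_mul' v₁ v₂ := eq_of_intertwines_of_isLinear hsq hiso hψ
    (exists_intertwines_of_isLinear hF hsq hiso ψ hψ (v₁ * v₂)).choose_spec
    (Intertwines.mul hsq (exists_intertwines_of_isLinear hF hsq hiso ψ hψ v₁).choose_spec
      (exists_intertwines_of_isLinear hF hsq hiso ψ hψ v₂).choose_spec)

/-- The defining property: `ψ ∘ transportHom ψ v = v ∘ ψ`. [cite: MochizukiFrdI2008, Prop. 2.2(ii)
p.45] -/
theorem intertwines_transportHom (hiso : IsOfIsotropicType F) (ψ : A ⟶ A') (hψ : IsLinear F ψ)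
    (v : BiratUnits F hF A') : Intertwines hF ψ (transportHom hF hsq hiso ψ hψ v) v :=
  (exists_intertwines_of_isLinear hF hsq hiso ψ hψ v).choose_spec

/-- Characterisation: `Intertwines ψ u v ↔ u = transportHom ψ v`.
[cite: MochizukiFrdI2008, Prop. 2.2(ii) p.45] -/
theorem intertwines_iff_eq_transportHom (hiso : IsOfIsotropicType F) (ψ : A ⟶ A')
    (hψ : IsLinear F ψ) (u : BiratUnits F hF A) (v : BiratUnits F hF A') :
    Intertwines hF ψ u v ↔ u = transportHom hF hsq hiso ψ hψ v :=
  ⟨fun h => eq_of_intertwines_of_isLinear hsq hiso hψ h (intertwines_transportHom hiso ψ hψ v),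
    fun h => h ▸ intertwines_transportHom hiso ψ hψ v⟩

/-- Functoriality: transport along `ψ₁ ≫ ψ₂` is transport along `ψ₂` followed by transport along
`ψ₁`
(contravariance of `O^×(−)`). [cite: MochizukiFrdI2008, Prop. 2.2(ii) p.45] -/
theorem transportHom_comp (hiso : IsOfIsotropicType F) (ψ₁ : A ⟶ A') (hψ₁ : IsLinear F ψ₁)
    (ψ₂ : A' ⟶ A'') (hψ₂ : IsLinear F ψ₂) (v : BiratUnits F hF A'') :
    transportHom hF hsq hiso (ψ₁ ≫ ψ₂) (IsLinear.comp F hψ₁ hψ₂) v =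
      transportHom hF hsq hiso ψ₁ hψ₁ (transportHom hF hsq hiso ψ₂ hψ₂ v) :=
  ((intertwines_iff_eq_transportHom hiso _ _ _ _).mp
    ((intertwines_transportHom hiso ψ₁ hψ₁ _).comp hsq
      (intertwines_transportHom hiso ψ₂ hψ₂ v))).symm

/-- Transport along the identity is the identity. [cite: MochizukiFrdI2008, Prop. 2.2(ii) p.45] -/
theorem transportHom_id (hiso : IsOfIsotropicType F) (hid : IsLinear F (𝟙 A))
    (v : BiratUnits F hF A) :
    transportHom hF hsq hiso (𝟙 A) hid v = v := by
  symm
  rw [← intertwines_iff_eq_transportHom, intertwines_iff_toHom_comm hsq,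
    CategoryTheory.Functor.map_id, Category.id_comp, Category.comp_id]

end BiratUnits

end PreFrobenioid

end Literature.AlgebraicGeometry.Frobenioids
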